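import Mathlib
import Summits.ABC.ABC.Theses.CongruentialReceptacle
import Summits.ABC.ABC.Theorems.CongruentialReceptacleTameLocalReceptacleDefs
import Summits.ABC.ABC.Theorems.CompactBalanceTransfer.Negative.CuspWeightedResidueFree
import Summits.ABC.ABC.Theorems.TameLocalReceptacle.Negative.TameLocalReceptacleWindowSixTightLemmas

/-!
# Crux `TameLocalReceptacle` (stmt-ABC-14354): the lower-window constant `6` is SHARP

Negative (tightness) lemma of the crux disprover (`refuter-cdisprove-stmt-ABC-14354-0`, cycle 1).

The crux asks for integer tables `t(p; i,j,k; r,s,z)` in the windows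
`c₁ (2(i+j+k) − 6 − ε) log p ≤ t ≤ |t| ≤ c₁' (i+j+k+1) log p` whose sum over `p ∣ abc` is
`≡ B (mod ℓⁿ)`, `|B| ≤ c₃`, on every `κ`-balanced abc-triple prime to `ℓ`.  Write `TLRWindow C` for the
same statement with the constant `6` of the LOWER window replaced by a real parameter `C`
(`tlrWindow_six_iff : TLRWindow 6 ↔ TameLocalReceptacle`, definitional).  The family is monotone in `C`
(`tlrWindow_mono`), and

* `not_tlrWindow_of_lt_six : C < 6 → ¬ TLRWindow C`.

So the crux sits exactly at the boundary of its one-parameter family: any witness must use the full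
Szpiro-shaped slack `6`; equivalently (rescaling `c₁`) the slope `2` of the lower window cannot be
raised.  WITNESS: the balanced triples `(2^K, 3^J − 2^K, 3^J)` with `3^J/2^K ∈ [10/9, 2)` (for every
`J ≥ 1` one of `J, J+1` qualifies, `exists_balanced_pow`): on them the lower windows alone sum to
`≥ c₁ ((6 − C − ε) K log 2 − O(1))` (`recSum_lower` + elementary bookkeeping), while at one prime
modulus `ℓ > (3^J)³` the congruence is an identity with `|B| ≤ c₃` (congruence to equality,
`CompactBalanceTransfer.Negative.eq_of_modEq_of_abs_le` of the sibling crux).  These are the triples whose Frey curves have Szpiro ratio `→ 6`; for the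
crux itself (`C = 6`) the same computation shows that any table is within total slack `ε K log 2 + O(1)`
of its lower window on all the data of these triples (recorded in the crux work file `Disproof.lean`).
-/

-- `Summit.<Summit>.<Problem>` is the mandated summit-side namespace (CONVENTIONS §2); for the
-- single-conjunct summit `ABC` the two coincide, so the duplicate `ABC.ABC` is deliberate.
set_option linter.dupNamespace false

namespace Summit.ABC.ABC.Theorems.TameLocalReceptacle

open Finset Literature.NumberTheory.DiophantineGeometry
open Summit.ABC.ABC.Theses.CongruentialReceptacle

/-! ### The one-parameter family of windows -/

/-! `TLRWindow C` denotes, in the docstrings below, the crux `TameLocalReceptacle` with the constant `6`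
of its lower window replaced by `C`; every statement spells this family member out in full (no
definition or notation is introduced). -/

/-- At `C = 6` the family member is the crux, definitionally. [folklore] -/
theorem tlrWindow_six_iff :
    (∀ κ : ℝ, 0 < κ → ∀ ε : ℝ, 0 < ε → ∃ c₁ c₁' c₃ : ℝ, 0 < c₁ ∧ ∃ m₀ : ℕ, ∀ ℓ n : ℕ,
      ℓ.Prime → 5 ≤ ℓ → m₀ ≤ ℓ ^ n → ∃ t : ℕ → ℕ → ℕ → ℕ → ℕ → ℕ → ℕ → ℤ,
      (∀ p i j k r s z : ℕ, p.Prime →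
        c₁ * (2 * ((i + j + k : ℕ) : ℝ) - 6 - ε) * Real.log p ≤ (t p i j k r s z : ℝ) ∧
          |(t p i j k r s z : ℝ)| ≤ c₁' * (((i + j + k : ℕ) : ℝ) + 1) * Real.log p) ∧
      ∀ a b c : ℕ, IsABCTriple a b c → κ * (c : ℝ) ≤ (a : ℝ) → κ * (c : ℝ) ≤ (b : ℝ) →
        ¬ ℓ ∣ a * b * c → ∃ B : ℤ, |(B : ℝ)| ≤ c₃ ∧
          (∑ p ∈ (a * b * c).primeFactors, t p (a.factorization p) (b.factorization p)
            (c.factorization p) (a / p ^ a.factorization p % p) (b / p ^ b.factorization p % p)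
            (c / p ^ c.factorization p % p)) ≡ B [ZMOD ((ℓ ^ n : ℕ) : ℤ)]) ↔
    TameLocalReceptacle := Iff.rfl

/-- The family is monotone: a larger `C` is a weaker lower window. [folklore] -/
theorem tlrWindow_mono {C C' : ℝ} (hCC' : C ≤ C')
    (h : (∀ κ : ℝ, 0 < κ → ∀ ε : ℝ, 0 < ε → ∃ c₁ c₁' c₃ : ℝ, 0 < c₁ ∧ ∃ m₀ : ℕ, ∀ ℓ n : ℕ,
      ℓ.Prime → 5 ≤ ℓ → m₀ ≤ ℓ ^ n → ∃ t : ℕ → ℕ → ℕ → ℕ → ℕ → ℕ → ℕ → ℤ,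
      (∀ p i j k r s z : ℕ, p.Prime →
        c₁ * (2 * ((i + j + k : ℕ) : ℝ) - C - ε) * Real.log p ≤ (t p i j k r s z : ℝ) ∧
          |(t p i j k r s z : ℝ)| ≤ c₁' * (((i + j + k : ℕ) : ℝ) + 1) * Real.log p) ∧
      ∀ a b c : ℕ, IsABCTriple a b c → κ * (c : ℝ) ≤ (a : ℝ) → κ * (c : ℝ) ≤ (b : ℝ) →
        ¬ ℓ ∣ a * b * c → ∃ B : ℤ, |(B : ℝ)| ≤ c₃ ∧
          (∑ p ∈ (a * b * c).primeFactors, t p (a.factorization p) (b.factorization p)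
            (c.factorization p) (a / p ^ a.factorization p % p) (b / p ^ b.factorization p % p)
            (c / p ^ c.factorization p % p)) ≡ B [ZMOD ((ℓ ^ n : ℕ) : ℤ)])) :
    (∀ κ : ℝ, 0 < κ → ∀ ε : ℝ, 0 < ε → ∃ c₁ c₁' c₃ : ℝ, 0 < c₁ ∧ ∃ m₀ : ℕ, ∀ ℓ n : ℕ,
      ℓ.Prime → 5 ≤ ℓ → m₀ ≤ ℓ ^ n → ∃ t : ℕ → ℕ → ℕ → ℕ → ℕ → ℕ → ℕ → ℤ,
      (∀ p i j k r s z : ℕ, p.Prime →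
        c₁ * (2 * ((i + j + k : ℕ) : ℝ) - C' - ε) * Real.log p ≤ (t p i j k r s z : ℝ) ∧
          |(t p i j k r s z : ℝ)| ≤ c₁' * (((i + j + k : ℕ) : ℝ) + 1) * Real.log p) ∧
      ∀ a b c : ℕ, IsABCTriple a b c → κ * (c : ℝ) ≤ (a : ℝ) → κ * (c : ℝ) ≤ (b : ℝ) →
        ¬ ℓ ∣ a * b * c → ∃ B : ℤ, |(B : ℝ)| ≤ c₃ ∧
          (∑ p ∈ (a * b * c).primeFactors, t p (a.factorization p) (b.factorization p)
            (c.factorization p) (a / p ^ a.factorization p % p) (b / p ^ b.factorization p % p)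
            (c / p ^ c.factorization p % p)) ≡ B [ZMOD ((ℓ ^ n : ℕ) : ℤ)]) := by
  intro κ hκ ε hε
  obtain ⟨c₁, c₁', c₃, hc₁, m₀, H⟩ := h κ hκ ε hε
  refine ⟨c₁, c₁', c₃, hc₁, m₀, fun ℓ n hℓ h5 hm => ?_⟩
  obtain ⟨t, hw, hsum⟩ := H ℓ n hℓ h5 hm
  refine ⟨t, fun p i j k r s z hp => ⟨?_, (hw p i j k r s z hp).2⟩, hsum⟩
  have h1 := (hw p i j k r s z hp).1
  have hlog : 0 ≤ Real.log p := Real.log_natCast_nonneg p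
  have h2 : c₁ * (2 * ((i + j + k : ℕ) : ℝ) - C' - ε) * Real.log p ≤
      c₁ * (2 * ((i + j + k : ℕ) : ℝ) - C - ε) * Real.log p := by
    apply mul_le_mul_of_nonneg_right _ hlog
    exact mul_le_mul_of_nonneg_left (by linarith) hc₁.le
  exact h2.trans h1

/-! ### The theorem -/

/-- **The lower-window constant `6` is sharp** (case `0 ≤ C < 6`): witnessed by the balanced triples
`(2^K, 3^J − 2^K, 3^J)`. [folklore] -/
theorem not_tlrWindow_of_nonneg_of_lt_six {C : ℝ} (hC0 : 0 ≤ C) (hC : C < 6) :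
    ¬ (∀ κ : ℝ, 0 < κ → ∀ ε : ℝ, 0 < ε → ∃ c₁ c₁' c₃ : ℝ, 0 < c₁ ∧ ∃ m₀ : ℕ, ∀ ℓ n : ℕ,
      ℓ.Prime → 5 ≤ ℓ → m₀ ≤ ℓ ^ n → ∃ t : ℕ → ℕ → ℕ → ℕ → ℕ → ℕ → ℕ → ℤ,
      (∀ p i j k r s z : ℕ, p.Prime →
        c₁ * (2 * ((i + j + k : ℕ) : ℝ) - C - ε) * Real.log p ≤ (t p i j k r s z : ℝ) ∧
          |(t p i j k r s z : ℝ)| ≤ c₁' * (((i + j + k : ℕ) : ℝ) + 1) * Real.log p) ∧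
      ∀ a b c : ℕ, IsABCTriple a b c → κ * (c : ℝ) ≤ (a : ℝ) → κ * (c : ℝ) ≤ (b : ℝ) →
        ¬ ℓ ∣ a * b * c → ∃ B : ℤ, |(B : ℝ)| ≤ c₃ ∧
          (∑ p ∈ (a * b * c).primeFactors, t p (a.factorization p) (b.factorization p)
            (c.factorization p) (a / p ^ a.factorization p % p) (b / p ^ b.factorization p % p)
            (c / p ^ c.factorization p % p)) ≡ B [ZMOD ((ℓ ^ n : ℕ) : ℤ)]) := by
  intro H
  set η : ℝ := (6 - C) / 2 with hη
  have hη0 : 0 < η := by rw [hη]; linarith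
  obtain ⟨c₁, c₁', c₃, hc₁, m₀, H⟩ := H (1 / 10) (by norm_num) η hη0
  have hlog2 : 0 < Real.log 2 := Real.log_pos (by norm_num)
  have hL2 : Real.log 2 ≤ 1 := by have := Real.log_two_lt_d9; linarith
  have hL3 : Real.log 3 ≤ 2 := by
    have := Real.log_le_sub_one_of_pos (by norm_num : (0 : ℝ) < 3); linarith
  have hL30 : 0 ≤ Real.log 3 := Real.log_nonneg (by norm_num)
  -- threshold for the exponent
  set T : ℝ := (c₃ / c₁ + 32) / (η * Real.log 2) with hT
  obtain ⟨J, hJ⟩ := exists_nat_gt T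
  obtain ⟨J', K, hJJ', -, h2K, h3J, hbal⟩ := exists_balanced_pow J
  -- the witness triple (2^K, 3^J' - 2^K, 3^J')
  have hpos3 : 0 < 3 ^ J' := by positivity
  have hac : 2 ^ K < 3 ^ J' := by omega
  set a : ℕ := 2 ^ K with ha_def
  set c : ℕ := 3 ^ J' with hc_def
  have ha0 : 0 < a := by positivity
  have hc0 : 0 < c := hpos3
  obtain ⟨b, hb_def⟩ : ∃ b : ℕ, b = c - a := ⟨_, rfl⟩
  have hb0 : 0 < b := by omega
  have hsum : a + b = c := by omega
  have hbc : b ≤ c := by omega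
  have hcop : Nat.Coprime a b := by
    have h23 : Nat.Coprime a c := Nat.Coprime.pow K J' (by norm_num)
    have hg : Nat.gcd a b = Nat.gcd a c := by
      rw [hb_def]; exact Nat.gcd_sub_self_right hac.le
    exact hg.trans h23
  have habc : IsABCTriple a b c := ⟨ha0, hb0, hsum, hcop⟩
  -- casts
  have hbR : (b : ℝ) = (c : ℝ) - (a : ℝ) := by
    have : ((a + b : ℕ) : ℝ) = (c : ℝ) := by rw [hsum]
    push_cast at this; linarith
  have haR : (a : ℝ) = (2 : ℝ) ^ K := by rw [ha_def]; push_cast; ring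
  have hcR : (c : ℝ) = (3 : ℝ) ^ J' := by rw [hc_def]; push_cast; ring
  -- balance at κ = 1/10
  have hbal_a : (1 / 10 : ℝ) * (c : ℝ) ≤ (a : ℝ) := by
    have h1 : ((3 ^ J' : ℕ) : ℝ) < ((2 ^ (K + 1) : ℕ) : ℝ) := by exact_mod_cast h3J
    push_cast at h1
    rw [pow_succ] at h1
    have hcnn : (0 : ℝ) ≤ c := by positivity
    rw [haR, hcR] at *
    linarith
  have hbal_b : (1 / 10 : ℝ) * (c : ℝ) ≤ (b : ℝ) := by
    have h1 : ((10 * 2 ^ K : ℕ) : ℝ) ≤ ((9 * 3 ^ J' : ℕ) : ℝ) := by exact_mod_cast hbal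
    push_cast at h1
    rw [hbR, haR, hcR]
    linarith
  -- one prime modulus above everything
  obtain ⟨ℓ, hℓge, hℓ⟩ := Nat.exists_infinite_primes (c ^ 3 + 5)
  have h5 : 5 ≤ ℓ := le_trans (Nat.le_add_left 5 (c ^ 3)) hℓge
  have hℓ1 : 1 < ℓ := by omega
  set Y : ℝ := |c₁'| * ((3 * c + 1 : ℕ) : ℝ) * ((c ^ 3 : ℕ) : ℝ) * ((c ^ 3 + 1 : ℕ) : ℝ) with hY
  set n : ℕ := max m₀ (⌈Y + |c₃|⌉₊ + 1) with hn
  have hm₀ : m₀ ≤ ℓ ^ n := le_trans (le_max_left _ _) (Nat.lt_pow_self hℓ1).le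
  obtain ⟨t, hw, hcong⟩ := H ℓ n hℓ h5 hm₀
  -- the upper window forces c₁' ≥ 0
  have hc₁' : 0 ≤ c₁' := by
    have hwin := (hw ℓ 0 0 0 0 0 0 hℓ).2
    have hlogℓ : 0 < Real.log ℓ := Real.log_pos (by exact_mod_cast hℓ1)
    have h0 : 0 ≤ c₁' * ((((0 + 0 + 0 : ℕ) : ℝ)) + 1) * Real.log ℓ := (abs_nonneg _).trans hwin
    simp only [add_zero, Nat.cast_zero, zero_add, mul_one] at h0
    nlinarith
  -- ℓ ∤ abc
  have habcpos : 0 < a * b * c := by positivity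
  have hale : a ≤ c := hac.le
  have habcc : a * b * c ≤ c ^ 3 := by
    calc a * b * c ≤ c * c * c := by gcongr
      _ = c ^ 3 := by ring
  have hndvd : ¬ ℓ ∣ a * b * c := by
    intro hd
    have := Nat.le_of_dvd habcpos hd
    omega
  obtain ⟨B, hB, hmod⟩ := hcong a b c habc hbal_a hbal_b hndvd
  -- congruence to equality
  have hbound : |(recSum t a b c : ℝ)| ≤ Y := by
    have h1 := abs_recSum_le (fun p i j k r s z hp => (hw p i j k r s z hp).2) hc₁' ha0 hb0 hc0
      hac.le hbc le_rfl
    rw [hY, abs_of_nonneg hc₁']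
    exact h1
  have hmod' : recSum t a b c ≡ B [ZMOD ((ℓ ^ n : ℕ) : ℤ)] := hmod
  have hEq : recSum t a b c = B := by
    refine Summit.ABC.ABC.Theorems.CompactBalanceTransfer.Negative.eq_of_modEq_of_abs_le hmod' hbound hB ?_
    have h3 : (Y + |c₃| : ℝ) < n := by
      have h8 : ⌈Y + |c₃|⌉₊ + 1 ≤ n := le_max_right _ _
      have h9 : ((⌈Y + |c₃|⌉₊ + 1 : ℕ) : ℝ) ≤ (n : ℝ) := by exact_mod_cast h8
      have h10 := Nat.le_ceil (Y + |c₃|)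
      push_cast at h9
      linarith
    have h4 : (n : ℝ) < ((ℓ ^ n : ℕ) : ℝ) := by exact_mod_cast Nat.lt_pow_self hℓ1
    have h6 : c₃ ≤ |c₃| := le_abs_self _
    linarith
  -- upper side: the sum is at most c₃
  have hup : (recSum t a b c : ℝ) ≤ c₃ := by
    rw [hEq]; exact (le_abs_self _).trans hB
  -- lower side: the summed lower window
  have hlow := recSum_lower (C := C) (ε := η) (c₁ := c₁) (t := t)
    (fun p i j k r s z hp => (hw p i j k r s z hp).1) ha0.ne' hb0.ne' hc0.ne'
  -- bookkeeping
  have hb0R : (0 : ℝ) < b := by exact_mod_cast hb0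
  have hlogabc : Real.log ((a * b * c : ℕ) : ℝ) =
      (K : ℝ) * Real.log 2 + Real.log b + (J' : ℝ) * Real.log 3 := by
    push_cast
    rw [haR, hcR, Real.log_mul (by positivity) (by positivity), Real.log_mul (by positivity) hb0R.ne',
      Real.log_pow, Real.log_pow]
  have hSum : ∑ p ∈ (a * b * c).primeFactors, Real.log p ≤ Real.log 2 + Real.log 3 + Real.log b := by
    have h := sum_log_primeFactors_le K J' hb0
    rw [ha_def, hc_def]
    exact h
  have hlb0 : 0 ≤ Real.log b := Real.log_natCast_nonneg b
  have hlbx : Real.log b ≤ (J' : ℝ) * Real.log 3 := by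
    have h1 : Real.log b ≤ Real.log c := Real.log_le_log hb0R (by exact_mod_cast hbc)
    rw [hcR, Real.log_pow] at h1
    exact h1
  have hyx : (K : ℝ) * Real.log 2 ≤ (J' : ℝ) * Real.log 3 := by
    have h1 : ((2 ^ K : ℕ) : ℝ) ≤ ((3 ^ J' : ℕ) : ℝ) := by exact_mod_cast h2K
    push_cast at h1
    have h2 := Real.log_le_log (by positivity) h1
    rw [Real.log_pow, Real.log_pow] at h2
    exact h2
  have hxy : (J' : ℝ) * Real.log 3 ≤ (K : ℝ) * Real.log 2 + Real.log 2 := by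
    have h1 : ((3 ^ J' : ℕ) : ℝ) ≤ ((2 ^ (K + 1) : ℕ) : ℝ) := by exact_mod_cast h3J.le
    push_cast at h1
    have h2 := Real.log_le_log (by positivity) h1
    rw [Real.log_pow, Real.log_pow] at h2
    push_cast at h2
    linarith
  -- K ≥ J
  have hKJ : J ≤ K := by
    have h1 : 2 ^ J' ≤ 3 ^ J' := Nat.pow_le_pow_left (by norm_num) J'
    have h2 : 2 ^ J' < 2 ^ (K + 1) := lt_of_le_of_lt h1 h3J
    have h3 : J' < K + 1 := (Nat.pow_lt_pow_iff_right (by norm_num)).mp h2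
    omega
  have hKT : T < K := lt_of_lt_of_le hJ (by exact_mod_cast hKJ)
  -- the main inequality: c₁ * (η K log 2 - 20) ≤ c₃
  have hCη : C + η ≤ 6 := by rw [hη]; linarith
  have hCη0 : 0 ≤ C + η := by linarith
  have hmx : (1 - C / 2) * ((J' : ℝ) * Real.log 3) ≥
      (1 - C / 2) * ((K : ℝ) * Real.log 2) - 2 * Real.log 2 := by
    rcases le_or_gt 0 (1 - C / 2) with hm | hm
    · have h1 : (1 - C / 2) * ((K : ℝ) * Real.log 2) ≤ (1 - C / 2) * ((J' : ℝ) * Real.log 3) :=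
        mul_le_mul_of_nonneg_left hyx hm
      linarith
    · have h1 : (1 - C / 2) * ((K : ℝ) * Real.log 2 + Real.log 2) ≤ (1 - C / 2) * ((J' : ℝ) * Real.log 3) :=
        mul_le_mul_of_nonpos_left hxy hm.le
      have h2 : 0 ≤ (1 - C / 2 + 2) * Real.log 2 := mul_nonneg (by linarith) hlog2.le
      linarith
  have hkey : c₁ * (η * ((K : ℝ) * Real.log 2) - 20) ≤ c₃ := by
    have h1 : c₁ * (2 * ((K : ℝ) * Real.log 2 + Real.log b + (J' : ℝ) * Real.log 3) -
        (C + η) * (Real.log 2 + Real.log 3 + Real.log b)) ≤ c₃ := by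
      refine le_trans ?_ (hlow.trans hup)
      rw [hlogabc]
      apply mul_le_mul_of_nonneg_left _ hc₁.le
      have := mul_le_mul_of_nonneg_left hSum hCη0
      linarith
    have h2 : η * ((K : ℝ) * Real.log 2) - 20 ≤ 2 * ((K : ℝ) * Real.log 2 + Real.log b + (J' : ℝ) * Real.log 3) -
        (C + η) * (Real.log 2 + Real.log 3 + Real.log b) := by
      have hneg : 2 - C - η ≤ 0 := by rw [hη]; linarith
      have f1 : (2 - C - η) * ((J' : ℝ) * Real.log 3) ≤ (2 - C - η) * Real.log b :=
        mul_le_mul_of_nonpos_left hlbx hneg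
      have f2 : (C + η) * (Real.log 2 + Real.log 3) ≤ 6 * 3 :=
        mul_le_mul hCη (by linarith) (by linarith) (by norm_num)
      have p1 : η * ((J' : ℝ) * Real.log 3) = 3 * ((J' : ℝ) * Real.log 3) - C * ((J' : ℝ) * Real.log 3) / 2 := by
        rw [hη]; ring
      have p2 : η * ((K : ℝ) * Real.log 2) = 3 * ((K : ℝ) * Real.log 2) - C * ((K : ℝ) * Real.log 2) / 2 := by
        rw [hη]; ring
      have p3 : η * Real.log b = 3 * Real.log b - C * Real.log b / 2 := by rw [hη]; ring
      have p4 : η * Real.log 2 = 3 * Real.log 2 - C * Real.log 2 / 2 := by rw [hη]; ring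
      have p5 : η * Real.log 3 = 3 * Real.log 3 - C * Real.log 3 / 2 := by rw [hη]; ring
      linarith [f1, f2, hmx, p1, p2, p3, p4, p5]
    exact (mul_le_mul_of_nonneg_left h2 hc₁.le).trans h1
  -- and the threshold contradicts it
  have hpos : 0 < η * Real.log 2 := mul_pos hη0 hlog2
  have hK2 : c₃ / c₁ + 32 < (K : ℝ) * (η * Real.log 2) := (div_lt_iff₀ hpos).mp hKT
  have hK3 : c₁ * (c₃ / c₁ + 32) < c₁ * ((K : ℝ) * (η * Real.log 2)) := mul_lt_mul_of_pos_left hK2 hc₁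
  have e : c₁ * (c₃ / c₁ + 32) = c₃ + 32 * c₁ := by field_simp
  have e2 : c₁ * ((K : ℝ) * (η * Real.log 2)) = c₁ * (η * ((K : ℝ) * Real.log 2)) := by ring
  rw [e, e2] at hK3
  have e3 : c₁ * (η * ((K : ℝ) * Real.log 2) - 20) = c₁ * (η * ((K : ℝ) * Real.log 2)) - 20 * c₁ := by ring
  rw [e3] at hkey
  linarith

/-- **The lower-window constant `6` of `TameLocalReceptacle` cannot be lowered**: for every `C < 6` the
crux with lower window `c₁ (2(i+j+k) − C − ε) log p` is false (witness: the balanced triples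
`(2^K, 3^J − 2^K, 3^J)`, whose lower windows alone sum to `c₁ ((6 − C − ε) K log 2 − O(1))` while
the congruence at one large prime modulus is an identity `= B`, `|B| ≤ c₃`).  Since
`TLRWindow 6 ↔ TameLocalReceptacle` (`tlrWindow_six_iff`) and the family is monotone
(`tlrWindow_mono`), the crux sits exactly on the boundary of its window family. [folklore] -/
theorem not_tlrWindow_of_lt_six {C : ℝ} (hC : C < 6) :
    ¬ (∀ κ : ℝ, 0 < κ → ∀ ε : ℝ, 0 < ε → ∃ c₁ c₁' c₃ : ℝ, 0 < c₁ ∧ ∃ m₀ : ℕ, ∀ ℓ n : ℕ,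
      ℓ.Prime → 5 ≤ ℓ → m₀ ≤ ℓ ^ n → ∃ t : ℕ → ℕ → ℕ → ℕ → ℕ → ℕ → ℕ → ℤ,
      (∀ p i j k r s z : ℕ, p.Prime →
        c₁ * (2 * ((i + j + k : ℕ) : ℝ) - C - ε) * Real.log p ≤ (t p i j k r s z : ℝ) ∧
          |(t p i j k r s z : ℝ)| ≤ c₁' * (((i + j + k : ℕ) : ℝ) + 1) * Real.log p) ∧
      ∀ a b c : ℕ, IsABCTriple a b c → κ * (c : ℝ) ≤ (a : ℝ) → κ * (c : ℝ) ≤ (b : ℝ) →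
        ¬ ℓ ∣ a * b * c → ∃ B : ℤ, |(B : ℝ)| ≤ c₃ ∧
          (∑ p ∈ (a * b * c).primeFactors, t p (a.factorization p) (b.factorization p)
            (c.factorization p) (a / p ^ a.factorization p % p) (b / p ^ b.factorization p % p)
            (c / p ^ c.factorization p % p)) ≡ B [ZMOD ((ℓ ^ n : ℕ) : ℤ)]) := by
  intro h
  rcases le_or_gt 0 C with h0 | h0
  · exact not_tlrWindow_of_nonneg_of_lt_six h0 hC h
  · exact not_tlrWindow_of_nonneg_of_lt_six le_rfl (by norm_num) (tlrWindow_mono h0.le h)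

end Summit.ABC.ABC.Theorems.TameLocalReceptacle
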